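/-
Copyright (c) 2026 the pub-hodgecm-mathlib formalisation cell (harness21).  Prover seat hodgecm-mathlib-K2Liu-p13 (g2), Track B «K2-LIT»,
#184♮ = hLiu418 = `stmt-HodgeConjecture-24832`; Road I v3 organ U1-CT-ind STAGE 2 (Q2), file F5-k (payer of ★ F5-e's binder `hνN : νN = Φ_*(μ_Z × μ)`).
-/
import Summits.HodgeConjecture.HodgeConjecture.Theorems.K2LiuKlingenUnipotentAdelicChart     -- ★ F5-i: the Heisenberg chart (+ ★ F4-1, F4-0)
import Summits.HodgeConjecture.HodgeConjecture.Theorems.K2LiuKlingenInnerSectionLeviLaw   -- ★ F5-c: `nKlingen_eq_uPlus_mul`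
import Mathlib.MeasureTheory.Measure.Haar.Unique                                          -- `isMulLeftInvariant_eq_smul`
import Mathlib.MeasureTheory.Measure.Prod
import HarnessLib

/-!
# Crux `HLiu418`, Road I v3, organ U1 stage 2 (Q2), file F5-k: THE HAAR MEASURE OF A HEISENBERG GROUP IS THE PRODUCT MEASURE IN SHEAR COORDINATES —
# generic shear invariance (`MeasurePreserving.skew_product`) and the product structure `νN = Φ_*((c•μ_Z) × (μ_Y × μ_T))` of every Haar measure on `N_Q(𝔸)`

Cell `hodgecm-mathlib`, crux item hLiu418 = `stmt-HodgeConjecture-24832`; squad K2 ∕ K2Liu; LEAD F0P6-plan (g14), co-dealer K2E5-plan (g7); prover K2Liu-p13 (g2).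
THEOREMS ONLY (no `def`, no instance, no notation, no named-fact hypothesis, no `sorry`); lane `--supports stmt-HodgeConjecture-24832 --as helper` (count-neutral).
* §1 GENERIC.  `Z, Y, T` measurable additive groups with left-invariant s-finite measures `μ_Z, μ_Y, μ_T`; a SHEAR `S(z;y,t) = (z₀+z; y₀+y+λ(z,t), t₀+t)` with `λ`
  jointly measurable preserves `μ_Z × (μ_Y × μ_T)` (**`measurePreserving_heisenbergShear`**: translation ∘ `skew_product` over the base `Z`, inner `skew_product` over `T`
  after a swap); hence for a measurable chart `Φ : Z × (Y × T) → N` onto a group `N` whose multiplication reads as such shears (`hmul`), **`isMulLeftInvariant_map_chart`**: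
  `Φ_*(μ_Z × (μ_Y × μ_T))` is left invariant.
* §2 KLINGEN (`n = 2`, transport clause (T1) BY VALUE).  With the chart `Φ(z;y,t) = Ψ(n_Q(y,z,t))` of ★ F5-i (Heisenberg law `klingenChart_mul`, `λ_{p₀}(z,t) = zσ(t₀) − tσ(z₀)`):
  **`isMulLeftInvariant_map_klingenChart`**; with the continuous inverse coordinates (★ F5-i `continuous_klingenCoords`) `Φ_*μ` is finite on compacts
  (`isFiniteMeasureOnCompacts_map_klingenChart`); so for every HAAR measure `νN` on `N_Q(𝔸)` (locally compact, second countable): **`exists_haar_eq_map_klingenChart`**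
  `∃ c : ℝ≥0, νN = (((c : ℝ≥0∞) • μ_Z).prod (μ_Y.prod μ_T)).map Φ` (Mathlib `isMulLeftInvariant_eq_smul`) — ★ F5-e `klingenInner_eq_mul_integral_fibre`'s `hνN` with
  `P := ↥Y × 𝔸_L`, `Φ(z,p) = Ψ(u₊(z)) · Ψ(n_Q(y_p,0,t_p))` (★ F5-c `nKlingen_eq_uPlus_mul`, recorded as `klingenChart_eq_uPlus_mul`).
[Weil1965, §37–§39], [Folland1995, §2.2 (Haar measure on the Heisenberg group)], [MoeglinWaldspurger1995, I.2.1], [CogdellAnalyticTheory2004, §2.3].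
HONEST LABEL.  Count-neutral helper: `HC_CM` is proved only modulo the 7 printed citations (2 remaining named inputs: hLiu418 = `stmt-HodgeConjecture-24832`,
h413 = `stmt-HodgeConjecture-24833`) until rung 0 closes.
-/

set_option autoImplicit false
set_option linter.dupNamespace false -- the mandated namespace repeats `HodgeConjecture.HodgeConjecture`

noncomputable section

open scoped Matrix ENNReal NNReal
open NumberField IsDedekindDomain MeasureTheory MeasureTheory.Measure Function

namespace Summit.HodgeConjecture.HodgeConjecture.Cruxes.HLiu418.K2LiuHeisenbergProductHaar

/-! ## §1 Generic: shears preserve product Haar measure; a Heisenberg chart pushes the product measure to a left-invariant one -/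

section Generic

variable {Z Y T : Type*} [AddCommGroup Z] [AddCommGroup Y] [AddCommGroup T]
  [MeasurableSpace Z] [MeasurableSpace Y] [MeasurableSpace T] [MeasurableAdd Z] [MeasurableAdd₂ Y] [MeasurableAdd₂ T]
  (μZ : Measure Z) (μY : Measure Y) (μT : Measure T) [SFinite μZ] [SFinite μY] [SFinite μT]
  [μZ.IsAddLeftInvariant] [μY.IsAddLeftInvariant] [μT.IsAddLeftInvariant]

/-- **A HEISENBERG SHEAR PRESERVES THE PRODUCT MEASURE**: `(z; y, t) ↦ (z₀ + z; y₀ + y + λ(z,t), t₀ + t)` is measure preserving on `μ_Z × (μ_Y × μ_T)` for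
left-invariant s-finite `μ_Z, μ_Y, μ_T` and jointly measurable `λ` (a `y`-translation fibrewise over `T` after a swap, then over the base `Z`: twice Mathlib
`MeasurePreserving.skew_product`). [cite: Folland1995, §2.2] [cite: Weil1965, §39] -/
theorem measurePreserving_heisenbergShear (z₀ : Z) (y₀ : Y) (t₀ : T) {lam : Z → T → Y} (hlam : Measurable (uncurry lam)) :
    MeasurePreserving (fun p : Z × (Y × T) => (z₀ + p.1, (y₀ + p.2.1 + lam p.1 p.2.2, t₀ + p.2.2))) (μZ.prod (μY.prod μT)) (μZ.prod (μY.prod μT)) := by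
  have hfib : ∀ z, MeasurePreserving (fun q : Y × T => (y₀ + q.1 + lam z q.2, t₀ + q.2)) (μY.prod μT) (μY.prod μT) := by
    intro z
    have h1 : MeasurePreserving (fun q : T × Y => (t₀ + q.1, y₀ + q.2 + lam z q.1)) (μT.prod μY) (μT.prod μY) := by
      refine MeasurePreserving.skew_product (measurePreserving_add_left μT t₀) (g := fun t y => y₀ + y + lam z t) ?_
        (Filter.Eventually.of_forall fun t => ?_)
      · exact (measurable_const.add measurable_snd).add (hlam.comp (measurable_const.prodMk measurable_fst))
      · have hfun : (fun y => y₀ + y + lam z t) = fun y => (y₀ + lam z t) + y := funext fun y => by abel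
        rw [hfun]
        exact map_add_left_eq_self μY _
    exact ((measurePreserving_swap (μ := μT) (ν := μY)).comp h1).comp (measurePreserving_swap (μ := μY) (ν := μT))
  refine MeasurePreserving.skew_product (measurePreserving_add_left μZ z₀) (g := fun z (q : Y × T) => (y₀ + q.1 + lam z q.2, t₀ + q.2)) ?_
    (Filter.Eventually.of_forall fun z => (hfib z).map_eq)
  exact ((measurable_const.add measurable_snd.fst).add (hlam.comp (measurable_fst.prodMk measurable_snd.snd))).prodMk
    (measurable_const.add measurable_snd.snd)

variable {N : Type*} [Group N] [MeasurableSpace N] [MeasurableMul N]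

/-- **A HEISENBERG CHART PUSHES THE PRODUCT MEASURE TO A LEFT-INVARIANT MEASURE**: `Φ : Z × (Y × T) → N` measurable and onto, with
`Φ(p₀) · Φ(p) = Φ(z₀+z; y₀+y+λ_{p₀}(z,t), t₀+t)` for jointly measurable `λ_{p₀}` ⇒ `Φ_*(μ_Z × (μ_Y × μ_T))` is left invariant.
[cite: Folland1995, §2.2] [cite: Weil1965, §39] -/
theorem isMulLeftInvariant_map_chart (Φ : Z × (Y × T) → N) (hΦ : Measurable Φ) (hsurj : Surjective Φ)
    (lam : Z × (Y × T) → Z → T → Y) (hlam : ∀ p₀, Measurable (uncurry (lam p₀)))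
    (hmul : ∀ p₀ p, Φ p₀ * Φ p = Φ (p₀.1 + p.1, (p₀.2.1 + p.2.1 + lam p₀ p.1 p.2.2, p₀.2.2 + p.2.2))) :
    (Measure.map Φ (μZ.prod (μY.prod μT))).IsMulLeftInvariant := by
  refine ⟨fun n₀ => ?_⟩
  obtain ⟨p₀, rfl⟩ := hsurj n₀
  have hS := measurePreserving_heisenbergShear μZ μY μT p₀.1 p₀.2.1 p₀.2.2 (hlam p₀)
  rw [map_map (measurable_const_mul _) hΦ]
  have hcomp : ((fun n => Φ p₀ * n) ∘ Φ) = Φ ∘ (fun p : Z × (Y × T) => (p₀.1 + p.1, (p₀.2.1 + p.2.1 + lam p₀ p.1 p.2.2, p₀.2.2 + p.2.2))) :=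
    funext fun p => hmul p₀ p
  rw [hcomp, ← map_map hΦ hS.measurable, hS.map_eq]

end Generic

/-! ## §2 The Klingen instance: every Haar measure on `N_Q(𝔸)` is the pushed-forward product measure (`n = 2`) -/

open Literature.NumberTheory.Automorphic Literature.NumberTheory.Automorphic.UnitaryGroup
open Literature.NumberTheory.GelbartRogawski1991 Literature.NumberTheory.GelbartRogawski1991.GRConstruction
open Literature.NumberTheory.K2Lit.SiegelDoubled
open Summit.HodgeConjecture.HodgeConjecture.Cruxes.HLiu418.K2LiuDoubledUTwoTwoBorelFrame
open Summit.HodgeConjecture.HodgeConjecture.Cruxes.HLiu418.K2LiuKlingenParabolicDefs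
open Summit.HodgeConjecture.HodgeConjecture.Cruxes.HLiu418.K2LiuKlingenUnipotentDefs
open Summit.HodgeConjecture.HodgeConjecture.Cruxes.HLiu418.K2LiuKlingenUnipotentAdelicDefs
open Summit.HodgeConjecture.HodgeConjecture.Cruxes.HLiu418.K2LiuKlingenUnipotentAdelicChart
open Summit.HodgeConjecture.HodgeConjecture.Cruxes.HLiu418.K2LiuKlingenInnerSectionLeviLaw (nKlingen_eq_uPlus_mul)
open Summit.HodgeConjecture.HodgeConjecture.Cruxes.HLiu418.K2LiuSiegelDoubledLeviMatrix (conjAdele_conjAdele')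
open UnitaryDualPair

variable {L : Type} [Field L] [NumberField L] [IsCMField L]
variable {N M : ℕ} {e : Fin N × Fin M ≃ Fin 2}
  {dV : Fin N → L} {hdV : ∀ i, IsCMField.complexConj L (dV i) = dV i}
  {dW : Fin M → L} {hdW : ∀ i, IsCMField.complexConj L (dW i) = dW i}

/-- the `y`-coordinate `A₀₃ + A₀₂σ(A₀₁)` of `u ∈ N_Q(𝔸)` (`A` the matrix of `Ψ⁻¹u`) is skew. [cite: Xiong2013, §7 Lemma 7.1] -/
theorem klingenCoord_mem (Ψ : (quasiSplit (Fp L) L (IsCMField.complexConj L) (2 + 2)).Adelic ≃ₜ* HA L e dV hdV dW hdW)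
    (Y : AddSubgroup (AdeleRing (𝓞 L) L)) (hY : ∀ y, y ∈ Y ↔ conjAdele (Fp L) L (IsCMField.complexConj L) y = -y) (u : ↥(klingenUnipA Ψ)) :
    ((adelicVal (Fp L) L (IsCMField.complexConj L) (2 + 2) _ (Ψ.symm (u : HA L e dV hdV dW hdW)) : GL (Fin (2 + 2)) (AdeleRing (𝓞 L) L)) : Matrix (Fin (2 + 2)) (Fin (2 + 2)) (AdeleRing (𝓞 L) L)) 0 3 + ((adelicVal (Fp L) L (IsCMField.complexConj L) (2 + 2) _ (Ψ.symm (u : HA L e dV hdV dW hdW)) : GL (Fin (2 + 2)) (AdeleRing (𝓞 L) L)) : Matrix (Fin (2 + 2)) (Fin (2 + 2)) (AdeleRing (𝓞 L) L)) 0 2 * conjAdele (Fp L) L (IsCMField.complexConj L) (((adelicVal (Fp L) L (IsCMField.complexConj L) (2 + 2) _ (Ψ.symm (u : HA L e dV hdV dW hdW)) : GL (Fin (2 + 2)) (AdeleRing (𝓞 L) L)) : Matrix (Fin (2 + 2)) (Fin (2 + 2)) (AdeleRing (𝓞 L) L)) 0 1) ∈ Y := by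
  obtain ⟨y, hy, z, t, hu⟩ := (mem_klingenUnipA_iff Ψ (u : HA L e dV hdV dW hdW)).1 u.2
  have h := klingenCoords_transport_nKlingen (e := e) (dV := dV) (hdV := hdV) (dW := dW) (hdW := hdW) Ψ y hy z t
  rw [← hu] at h
  have h2 := congrArg (fun q : AdeleRing (𝓞 L) L × (AdeleRing (𝓞 L) L × AdeleRing (𝓞 L) L) => q.2.1) h
  simp only at h2
  rw [h2]
  exact (hY y).2 hy

/-- **the inverse chart is continuous into `𝔸_L × (Y × 𝔸_L)`** (★ F5-i `continuous_klingenCoords` + `klingenCoord_mem`). [cite: Weil1965, §37] -/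
theorem continuous_klingenInvChart (Ψ : (quasiSplit (Fp L) L (IsCMField.complexConj L) (2 + 2)).Adelic ≃ₜ* HA L e dV hdV dW hdW)
    (Y : AddSubgroup (AdeleRing (𝓞 L) L)) (hY : ∀ y, y ∈ Y ↔ conjAdele (Fp L) L (IsCMField.complexConj L) y = -y) :
    Continuous (fun u : ↥(klingenUnipA Ψ) => (((adelicVal (Fp L) L (IsCMField.complexConj L) (2 + 2) _ (Ψ.symm (u : HA L e dV hdV dW hdW)) : GL (Fin (2 + 2)) (AdeleRing (𝓞 L) L)) : Matrix (Fin (2 + 2)) (Fin (2 + 2)) (AdeleRing (𝓞 L) L)) 0 2, ((⟨((adelicVal (Fp L) L (IsCMField.complexConj L) (2 + 2) _ (Ψ.symm (u : HA L e dV hdV dW hdW)) : GL (Fin (2 + 2)) (AdeleRing (𝓞 L) L)) : Matrix (Fin (2 + 2)) (Fin (2 + 2)) (AdeleRing (𝓞 L) L)) 0 3 + ((adelicVal (Fp L) L (IsCMField.complexConj L) (2 + 2) _ (Ψ.symm (u : HA L e dV hdV dW hdW)) : GL (Fin (2 + 2)) (AdeleRing (𝓞 L) L)) : Matrix (Fin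 (2 + 2)) (Fin (2 + 2)) (AdeleRing (𝓞 L) L)) 0 2 * conjAdele (Fp L) L (IsCMField.complexConj L) (((adelicVal (Fp L) L (IsCMField.complexConj L) (2 + 2) _ (Ψ.symm (u : HA L e dV hdV dW hdW)) : GL (Fin (2 + 2)) (AdeleRing (𝓞 L) L)) : Matrix (Fin (2 + 2)) (Fin (2 + 2)) (AdeleRing (𝓞 L) L)) 0 1), klingenCoord_mem Ψ Y hY u⟩ : ↥Y), ((adelicVal (Fp L) L (IsCMField.complexConj L) (2 + 2) _ (Ψ.symm (u : HA L e dV hdV dW hdW)) : GL (Fin (2 + 2)) (AdeleRing (𝓞 L) L)) : Matrix (Fin (2 + 2)) (Fin (2 + 2)) (AdeleRing (𝓞 L) L)) 0 1))) := by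
  have h := (continuous_klingenCoords (e := e) (dV := dV) (hdV := hdV) (dW := dW) (hdW := hdW) Ψ).comp
    (continuous_subtype_val : Continuous fun u : ↥(klingenUnipA Ψ) => (u : HA L e dV hdV dW hdW))
  exact (continuous_fst.comp h).prodMk ((Continuous.subtype_mk (continuous_fst.comp (continuous_snd.comp h)) _).prodMk
    (continuous_snd.comp (continuous_snd.comp h)))

/-- the inverse chart is a left inverse of the chart. [cite: Xiong2013, §7 Lemma 7.1] -/
theorem klingenInvChart_chart (Ψ : (quasiSplit (Fp L) L (IsCMField.complexConj L) (2 + 2)).Adelic ≃ₜ* HA L e dV hdV dW hdW)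
    (Y : AddSubgroup (AdeleRing (𝓞 L) L)) (hY : ∀ y, y ∈ Y ↔ conjAdele (Fp L) L (IsCMField.complexConj L) y = -y) (p : AdeleRing (𝓞 L) L × (↥Y × AdeleRing (𝓞 L) L)) :
    (fun u : ↥(klingenUnipA Ψ) => (((adelicVal (Fp L) L (IsCMField.complexConj L) (2 + 2) _ (Ψ.symm (u : HA L e dV hdV dW hdW)) : GL (Fin (2 + 2)) (AdeleRing (𝓞 L) L)) : Matrix (Fin (2 + 2)) (Fin (2 + 2)) (AdeleRing (𝓞 L) L)) 0 2, ((⟨((adelicVal (Fp L) L (IsCMField.complexConj L) (2 + 2) _ (Ψ.symm (u : HA L e dV hdV dW hdW)) : GL (Fin (2 + 2)) (AdeleRing (𝓞 L) L)) : Matrix (Fin (2 + 2)) (Fin (2 + 2)) (AdeleRing (𝓞 L) L)) 0 3 + ((adelicVal (Fp L) L (IsCMField.complexConj L) (2 + 2) _ (Ψ.symm (u : HA L e dV hdV dW hdW)) : GL (Fin (2 + 2)) (AdeleRing (𝓞 L) L)) : Matrix (Fin (2 + 2)) (Fin (2 + 2)) (AdeleRing (𝓞 L) L)) 0 2 * conjAdele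 (Fp L) L (IsCMField.complexConj L) (((adelicVal (Fp L) L (IsCMField.complexConj L) (2 + 2) _ (Ψ.symm (u : HA L e dV hdV dW hdW)) : GL (Fin (2 + 2)) (AdeleRing (𝓞 L) L)) : Matrix (Fin (2 + 2)) (Fin (2 + 2)) (AdeleRing (𝓞 L) L)) 0 1), klingenCoord_mem Ψ Y hY u⟩ : ↥Y), ((adelicVal (Fp L) L (IsCMField.complexConj L) (2 + 2) _ (Ψ.symm (u : HA L e dV hdV dW hdW)) : GL (Fin (2 + 2)) (AdeleRing (𝓞 L) L)) : Matrix (Fin (2 + 2)) (Fin (2 + 2)) (AdeleRing (𝓞 L) L)) 0 1))) ((fun p : AdeleRing (𝓞 L) L × (↥Y × AdeleRing (𝓞 L) L) =>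
        (⟨Ψ (jAdelic L 4 (nKlingen (AdeleRing (𝓞 L) L) (conjAdele (Fp L) L (IsCMField.complexConj L)) (conjAdele_conjAdele' L)
            (p.2.1 : AdeleRing (𝓞 L) L) ((hY _).1 p.2.1.2) p.1 p.2.2)), transport_nKlingen_mem Ψ _ _ _ _⟩ : ↥(klingenUnipA Ψ))) p) = p := by
  have h := klingenCoords_transport_nKlingen (e := e) (dV := dV) (hdV := hdV) (dW := dW) (hdW := hdW) Ψ (p.2.1 : AdeleRing (𝓞 L) L) ((hY _).1 p.2.1.2) p.1 p.2.2
  refine Prod.ext ?_ (Prod.ext (Subtype.ext ?_) ?_)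
  · exact congrArg (fun q : AdeleRing (𝓞 L) L × (AdeleRing (𝓞 L) L × AdeleRing (𝓞 L) L) => q.1) h
  · exact congrArg (fun q : AdeleRing (𝓞 L) L × (AdeleRing (𝓞 L) L × AdeleRing (𝓞 L) L) => q.2.1) h
  · exact congrArg (fun q : AdeleRing (𝓞 L) L × (AdeleRing (𝓞 L) L × AdeleRing (𝓞 L) L) => q.2.2) h

section Transport

variable {SA : GL (Fin (2 + 2)) (AdeleRing (𝓞 L) L)}
  {Ψ : (quasiSplit (Fp L) L (IsCMField.complexConj L) (2 + 2)).Adelic ≃ₜ* HA L e dV hdV dW hdW}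
  (hΨ : ∀ g : (quasiSplit (Fp L) L (IsCMField.complexConj L) (2 + 2)).Adelic,
      (((Ψ g : HA L e dV hdV dW hdW) : GL (Fin (2 + 2)) (AdeleRing (𝓞 L) L)) : Matrix (Fin (2 + 2)) (Fin (2 + 2)) (AdeleRing (𝓞 L) L)) =
        (SA : Matrix (Fin (2 + 2)) (Fin (2 + 2)) (AdeleRing (𝓞 L) L)) *
          ((adelicVal (Fp L) L (IsCMField.complexConj L) (2 + 2) _ g : GL (Fin (2 + 2)) (AdeleRing (𝓞 L) L)) :
            Matrix (Fin (2 + 2)) (Fin (2 + 2)) (AdeleRing (𝓞 L) L)) *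
          ((SA⁻¹ : GL (Fin (2 + 2)) (AdeleRing (𝓞 L) L)) : Matrix (Fin (2 + 2)) (Fin (2 + 2)) (AdeleRing (𝓞 L) L)))

include hΨ in
/-- **`Φ_*(μ_Z × (μ_Y × μ_T))` IS LEFT-INVARIANT ON `N_Q(𝔸)`** (§1 with the Heisenberg law ★ F5-i `klingenChart_mul`, `λ_{p₀}(z,t) = zσ(t₀) − t₀σ(z)`).
[cite: Folland1995, §2.2] [cite: MoeglinWaldspurger1995, I.2.1] -/
theorem isMulLeftInvariant_map_klingenChart [MeasurableSpace (AdeleRing (𝓞 L) L)] [BorelSpace (AdeleRing (𝓞 L) L)] [SecondCountableTopology (AdeleRing (𝓞 L) L)]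
    [MeasurableSpace ↥(klingenUnipA Ψ)] [BorelSpace ↥(klingenUnipA Ψ)]
    (Y : AddSubgroup (AdeleRing (𝓞 L) L)) (hY : ∀ y, y ∈ Y ↔ conjAdele (Fp L) L (IsCMField.complexConj L) y = -y)
    (μZ : Measure (AdeleRing (𝓞 L) L)) (μY : Measure ↥Y) (μT : Measure (AdeleRing (𝓞 L) L)) [SFinite μZ] [SFinite μY] [SFinite μT]
    [μZ.IsAddLeftInvariant] [μY.IsAddLeftInvariant] [μT.IsAddLeftInvariant] :
    (Measure.map (fun p : AdeleRing (𝓞 L) L × (↥Y × AdeleRing (𝓞 L) L) =>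
        (⟨Ψ (jAdelic L 4 (nKlingen (AdeleRing (𝓞 L) L) (conjAdele (Fp L) L (IsCMField.complexConj L)) (conjAdele_conjAdele' L)
            (p.2.1 : AdeleRing (𝓞 L) L) ((hY _).1 p.2.1.2) p.1 p.2.2)), transport_nKlingen_mem Ψ _ _ _ _⟩ : ↥(klingenUnipA Ψ))) (μZ.prod (μY.prod μT))).IsMulLeftInvariant := by
  haveI : SecondCountableTopology ↥Y := TopologicalSpace.Subtype.secondCountableTopology (Y : Set (AdeleRing (𝓞 L) L))
  have hσc := continuous_conjAdele (Fp L) L (IsCMField.complexConj L)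
  refine isMulLeftInvariant_map_chart μZ μY μT _ (continuous_klingenChart Ψ hΨ Y hY).measurable (klingenChart_surjective Ψ Y hY)
    (fun p₀ z _ => (⟨z * conjAdele (Fp L) L (IsCMField.complexConj L) p₀.2.2 - p₀.2.2 * conjAdele (Fp L) L (IsCMField.complexConj L) z, (hY _).2 (skew_comm (conjAdele_conjAdele' L) z p₀.2.2)⟩ : ↥Y))
    (fun p₀ => ?_) (fun p₀ p => ?_)
  · exact (Continuous.subtype_mk ((continuous_fst.mul continuous_const).sub (continuous_const.mul (hσc.comp continuous_fst))) _).measurable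
  · exact klingenChart_mul Ψ Y hY p₀.1 p₀.2.1 p₀.2.2 p.1 p.2.1 p.2.2

include hΨ in
/-- **`Φ_*(μ_Z × (μ_Y × μ_T))` IS FINITE ON COMPACT SETS** (the inverse chart is continuous, so `Φ⁻¹(K)` lies in the compact image of `K`). [cite: Weil1965, §37] -/
theorem isFiniteMeasureOnCompacts_map_klingenChart [MeasurableSpace (AdeleRing (𝓞 L) L)] [BorelSpace (AdeleRing (𝓞 L) L)] [SecondCountableTopology (AdeleRing (𝓞 L) L)]
    [MeasurableSpace ↥(klingenUnipA Ψ)] [BorelSpace ↥(klingenUnipA Ψ)]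
    (Y : AddSubgroup (AdeleRing (𝓞 L) L)) (hY : ∀ y, y ∈ Y ↔ conjAdele (Fp L) L (IsCMField.complexConj L) y = -y)
    (μZ : Measure (AdeleRing (𝓞 L) L)) (μY : Measure ↥Y) (μT : Measure (AdeleRing (𝓞 L) L)) [SFinite μZ] [SFinite μY] [SFinite μT]
    [IsFiniteMeasureOnCompacts μZ] [IsFiniteMeasureOnCompacts μY] [IsFiniteMeasureOnCompacts μT] :
    IsFiniteMeasureOnCompacts (Measure.map (fun p : AdeleRing (𝓞 L) L × (↥Y × AdeleRing (𝓞 L) L) =>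
        (⟨Ψ (jAdelic L 4 (nKlingen (AdeleRing (𝓞 L) L) (conjAdele (Fp L) L (IsCMField.complexConj L)) (conjAdele_conjAdele' L)
            (p.2.1 : AdeleRing (𝓞 L) L) ((hY _).1 p.2.1.2) p.1 p.2.2)), transport_nKlingen_mem Ψ _ _ _ _⟩ : ↥(klingenUnipA Ψ))) (μZ.prod (μY.prod μT))) := by
  haveI : SecondCountableTopology ↥Y := TopologicalSpace.Subtype.secondCountableTopology (Y : Set (AdeleRing (𝓞 L) L))
  refine ⟨fun K hK => ?_⟩
  rw [Measure.map_apply (continuous_klingenChart Ψ hΨ Y hY).measurable hK.measurableSet]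
  have hsub : (fun p : AdeleRing (𝓞 L) L × (↥Y × AdeleRing (𝓞 L) L) =>
        (⟨Ψ (jAdelic L 4 (nKlingen (AdeleRing (𝓞 L) L) (conjAdele (Fp L) L (IsCMField.complexConj L)) (conjAdele_conjAdele' L)
            (p.2.1 : AdeleRing (𝓞 L) L) ((hY _).1 p.2.1.2) p.1 p.2.2)), transport_nKlingen_mem Ψ _ _ _ _⟩ : ↥(klingenUnipA Ψ))) ⁻¹' K ⊆ ((fun u : ↥(klingenUnipA Ψ) => (((adelicVal (Fp L) L (IsCMField.complexConj L) (2 + 2) _ (Ψ.symm (u : HA L e dV hdV dW hdW)) : GL (Fin (2 + 2)) (AdeleRing (𝓞 L) L)) : Matrix (Fin (2 + 2)) (Fin (2 + 2)) (AdeleRing (𝓞 L) L)) 0 2, ((⟨((adelicVal (Fp L) L (IsCMField.complexConj L) (2 + 2) _ (Ψ.symm (u : HA L e dV hdV dW hdW)) : GL (Fin (2 + 2)) (AdeleRing (𝓞 L) L)) : Matrix (Fin (2 + 2)) (Fin (2 + 2)) (AdeleRing (𝓞 L) L)) 0 3 + ((adelicVal (Fp L) L (IsCMField.complexConj L) (2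 + 2) _ (Ψ.symm (u : HA L e dV hdV dW hdW)) : GL (Fin (2 + 2)) (AdeleRing (𝓞 L) L)) : Matrix (Fin (2 + 2)) (Fin (2 + 2)) (AdeleRing (𝓞 L) L)) 0 2 * conjAdele (Fp L) L (IsCMField.complexConj L) (((adelicVal (Fp L) L (IsCMField.complexConj L) (2 + 2) _ (Ψ.symm (u : HA L e dV hdV dW hdW)) : GL (Fin (2 + 2)) (AdeleRing (𝓞 L) L)) : Matrix (Fin (2 + 2)) (Fin (2 + 2)) (AdeleRing (𝓞 L) L)) 0 1), klingenCoord_mem Ψ Y hY u⟩ : ↥Y), ((adelicVal (Fp L) L (IsCMField.complexConj L) (2 + 2) _ (Ψ.symm (u : HA L e dV hdV dW hdW)) : GL (Fin (2 + 2)) (AdeleRing (𝓞 L) L)) : Matrix (Fin (2 + 2)) (Fin (2 + 2)) (AdeleRing (𝓞 L) L)) 0 1))) '' K) := by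
    intro p hp
    exact ⟨_, hp, klingenInvChart_chart Ψ Y hY p⟩
  exact (measure_mono hsub).trans_lt ((hK.image (continuous_klingenInvChart Ψ Y hY)).measure_lt_top)

include hΨ in
/-- **(Q2) F5-k — EVERY HAAR MEASURE ON `N_Q(𝔸)` IS THE PUSHED-FORWARD PRODUCT MEASURE IN THE HEISENBERG CHART.**  `νN` a Haar measure on `N_Q(𝔸) = klingenUnipA Ψ`
(locally compact, second countable), `μ_Z, μ_T` additive Haar measures on `𝔸_L` and `μ_Y` on the skew part `Y` (s-finite); THEN
  `∃ c : ℝ≥0∞, c ≠ 0 ∧ c ≠ ∞ ∧ νN = ((c • μ_Z).prod (μ_Y.prod μ_T)).map Φ`,  `Φ(z; y, t) = Ψ(n_Q(y,z,t))`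
(uniqueness of Haar measure, Mathlib `isMulLeftInvariant_eq_smul`) — the binder `hνN` of ★ F5-e `klingenInner_eq_mul_integral_fibre` with `P := Y × 𝔸_L` and
`Φ(z,p) = Ψ(u₊(z)) · Ψ(n_Q(y_p, 0, t_p))` (`klingenChart_eq_uPlus_mul`). [cite: Folland1995, §2.2] [cite: Weil1965, §37–§39] [cite: MoeglinWaldspurger1995, I.2.1] -/
theorem exists_haar_eq_map_klingenChart [MeasurableSpace (AdeleRing (𝓞 L) L)] [BorelSpace (AdeleRing (𝓞 L) L)] [SecondCountableTopology (AdeleRing (𝓞 L) L)]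
    [MeasurableSpace ↥(klingenUnipA Ψ)] [BorelSpace ↥(klingenUnipA Ψ)] [LocallyCompactSpace ↥(klingenUnipA Ψ)] [SecondCountableTopology ↥(klingenUnipA Ψ)]
    (νN : Measure ↥(klingenUnipA Ψ)) [νN.IsHaarMeasure]
    (Y : AddSubgroup (AdeleRing (𝓞 L) L)) (hY : ∀ y, y ∈ Y ↔ conjAdele (Fp L) L (IsCMField.complexConj L) y = -y)
    (μZ : Measure (AdeleRing (𝓞 L) L)) (μY : Measure ↥Y) (μT : Measure (AdeleRing (𝓞 L) L)) [SFinite μZ] [SFinite μY] [SFinite μT]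
    [μZ.IsAddHaarMeasure] [μY.IsAddHaarMeasure] [μT.IsAddHaarMeasure] :
    ∃ c : ℝ≥0∞, c ≠ 0 ∧ c ≠ ∞ ∧ νN = Measure.map (fun p : AdeleRing (𝓞 L) L × (↥Y × AdeleRing (𝓞 L) L) =>
        (⟨Ψ (jAdelic L 4 (nKlingen (AdeleRing (𝓞 L) L) (conjAdele (Fp L) L (IsCMField.complexConj L)) (conjAdele_conjAdele' L)
            (p.2.1 : AdeleRing (𝓞 L) L) ((hY _).1 p.2.1.2) p.1 p.2.2)), transport_nKlingen_mem Ψ _ _ _ _⟩ : ↥(klingenUnipA Ψ))) ((c • μZ).prod (μY.prod μT)) := by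
  haveI : SecondCountableTopology ↥Y := TopologicalSpace.Subtype.secondCountableTopology (Y : Set (AdeleRing (𝓞 L) L))
  haveI := isMulLeftInvariant_map_klingenChart hΨ Y hY μZ μY μT
  haveI := isFiniteMeasureOnCompacts_map_klingenChart hΨ Y hY μZ μY μT
  obtain ⟨c, hc⟩ : ∃ c : ℝ≥0, Measure.map (fun p : AdeleRing (𝓞 L) L × (↥Y × AdeleRing (𝓞 L) L) =>
        (⟨Ψ (jAdelic L 4 (nKlingen (AdeleRing (𝓞 L) L) (conjAdele (Fp L) L (IsCMField.complexConj L)) (conjAdele_conjAdele' L)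
            (p.2.1 : AdeleRing (𝓞 L) L) ((hY _).1 p.2.1.2) p.1 p.2.2)), transport_nKlingen_mem Ψ _ _ _ _⟩ : ↥(klingenUnipA Ψ))) (μZ.prod (μY.prod μT)) = c • νN := ⟨_, isMulLeftInvariant_eq_smul _ νN⟩
  have hne : Measure.map (fun p : AdeleRing (𝓞 L) L × (↥Y × AdeleRing (𝓞 L) L) =>
        (⟨Ψ (jAdelic L 4 (nKlingen (AdeleRing (𝓞 L) L) (conjAdele (Fp L) L (IsCMField.complexConj L)) (conjAdele_conjAdele' L)
            (p.2.1 : AdeleRing (𝓞 L) L) ((hY _).1 p.2.1.2) p.1 p.2.2)), transport_nKlingen_mem Ψ _ _ _ _⟩ : ↥(klingenUnipA Ψ))) (μZ.prod (μY.prod μT)) ≠ 0 :=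
    (Measure.map_ne_zero_iff (continuous_klingenChart Ψ hΨ Y hY).measurable.aemeasurable).2 (NeZero.ne _)
  have hc0 : c ≠ 0 := by
    rintro rfl
    rw [zero_smul] at hc
    exact hne hc
  refine ⟨((c⁻¹ : ℝ≥0) : ℝ≥0∞), by simpa using hc0, ENNReal.coe_ne_top, ?_⟩
  rw [Measure.prod_smul_left, Measure.map_smul, hc, ← ENNReal.smul_def, smul_smul, inv_mul_cancel₀ hc0, one_smul]

/-- the chart in ★ F5-e's letters: `↑Φ(z; y, t) = Ψ(u₊(z)) · Ψ(n_Q(y, 0, t))` (★ F5-c `nKlingen_eq_uPlus_mul`). [cite: Xiong2013, §7 Lemma 7.1] -/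
theorem klingenChart_eq_uPlus_mul (Ψ' : (quasiSplit (Fp L) L (IsCMField.complexConj L) (2 + 2)).Adelic ≃ₜ* HA L e dV hdV dW hdW)
    (Y : AddSubgroup (AdeleRing (𝓞 L) L)) (hY : ∀ y, y ∈ Y ↔ conjAdele (Fp L) L (IsCMField.complexConj L) y = -y) (p : AdeleRing (𝓞 L) L × (↥Y × AdeleRing (𝓞 L) L)) :
    (((⟨Ψ' (jAdelic L 4 (nKlingen (AdeleRing (𝓞 L) L) (conjAdele (Fp L) L (IsCMField.complexConj L)) (conjAdele_conjAdele' L)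
            (p.2.1 : AdeleRing (𝓞 L) L) ((hY _).1 p.2.1.2) p.1 p.2.2)), transport_nKlingen_mem Ψ' _ _ _ _⟩ : ↥(klingenUnipA Ψ')) : ↥(klingenUnipA Ψ')) : HA L e dV hdV dW hdW) =
      Ψ' (jAdelic L 4 (uPlus (AdeleRing (𝓞 L) L) (conjAdele (Fp L) L (IsCMField.complexConj L)) (conjAdele_conjAdele' L) p.1)) *
        Ψ' (jAdelic L 4 (nKlingen (AdeleRing (𝓞 L) L) (conjAdele (Fp L) L (IsCMField.complexConj L)) (conjAdele_conjAdele' L) (p.2.1 : AdeleRing (𝓞 L) L) ((hY _).1 p.2.1.2) 0 p.2.2)) := by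
  rw [← map_mul, ← map_mul, ← nKlingen_eq_uPlus_mul]

end Transport

end Summit.HodgeConjecture.HodgeConjecture.Cruxes.HLiu418.K2LiuHeisenbergProductHaar

end
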